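import Summits.ResolutionOfSingularities.ResolutionOfSingularities.Theorems.UniversalCellsLocalToGlobalHSTowerDefs
import Literature.AlgebraicGeometry.Resolution.AlterationsStrong
import Literature.AlgebraicGeometry.Resolution.SurfaceResolutionReduction
import Literature.AlgebraicGeometry.Resolution.AlterationsNormalizationReduction
import Mathlib.AlgebraicGeometry.Morphisms.QuasiCompact
import HarnessLib

/-!
# `LocalToGlobal` (crux stmt-ResolutionOfSingularities-15232, route UniversalCells), line `Sketch`
# (idea `existence-certified-termination`) — stub `stub_reduce_to_normalization`

Helper file (`--supports stmt-ResolutionOfSingularities-15232`; does not close the item).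
Objects: `Theorems/UniversalCellsLocalToGlobalHSTowerDefs.lean` (the blind lex-maximal
Hilbert–Samuel tower: `hsCentre`, `hsStep`, `NormalVariety.step`, `stepπ`, `iterπ`, `IsResolvedOver`).

**Statement.** For `k` a field and `X` an integral scheme, separated, quasi-compact and locally
of finite type over `Spec k`, there are a normal variety `V : NormalVariety k` and `N : ℕ` with
`topologicalKrullDim V.X < N` such that a resolution of singularities of `V.X` gives one of `X`.

**Proof.** Take `V.X := normalization X` (the tree's `X^ν`, `NormalizationOfVarieties.lean`)
with structure morphism `normalizationι X ≫ f`.  The normalization morphism is finite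
(`isFinite_normalizationι` with E. Noether's finiteness of the integral closure,
`NoetherFiniteIntegralClosure_holds`), hence proper, so the composite is again separated,
locally of finite type and quasi-compact (instances compose); `X^ν` is integral, and all its
local rings are integrally closed (`isIntegrallyClosed_stalk_normalization`, Stacks 033H).
Dimension: `QuasiCompact f` over the affine base is `CompactSpace X`
(`HasAffineProperty.iff_of_isAffine`), so `topologicalKrullDim X ≤ d` for some `d : ℕ`
(`exists_topologicalKrullDim_le_of_locallyOfFiniteType`, Stacks 01TB/00OS), and
`dim X^ν = dim X` (`topologicalKrullDim_normalization`); take `N := d + 1`.  Descent of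
resolutions along the proper birational `X^ν → X` is `Scheme.HasResolution.of_normalization`
(`SurfaceResolutionReduction.lean`).  Sources: Zariski 1939 / Lipman 1978 (normalize first);
Liu 2002, §4.1.2 and §8.3.4.
-/

set_option linter.dupNamespace false -- mandated namespace of this single-conjunct summit

noncomputable section

open CategoryTheory AlgebraicGeometry TopologicalSpace Topology
open AlgebraicGeometry.Scheme.IdealSheafData
open Literature.AlgebraicGeometry.Resolution

namespace Summit.ResolutionOfSingularities.ResolutionOfSingularities.Theorems.LocalToGlobal.HSTower

/-! ## The stub -/

/-- **Stub `stub_reduce_to_normalization` of line `Sketch` — (reduction to the normalization, with a dimension bound).** An integral separated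
`k`-scheme of finite type has a normal model `V` (its normalization: finite, birational) of
finite dimension, along which resolutions descend. [folklore] -/
theorem stub_reduce_to_normalization (k : Type) [Field k] (X : Scheme.{0}) (f : X ⟶ Spec (.of k))
    [IsSeparated f] [LocallyOfFiniteType f] [QuasiCompact f] [IsIntegral X] :
    ∃ (V : NormalVariety k) (N : ℕ), topologicalKrullDim V.X < (N : WithBot ℕ∞) ∧
      (Scheme.HasResolution V.X → Scheme.HasResolution X) := by
  -- `X^ν → X` is finite (E. Noether), hence proper: the composite `X^ν → Spec k` inherits
  -- separatedness, (local) finite type and quasi-compactness.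
  haveI : IsFinite (normalizationι X) :=
    isFinite_normalizationι X NoetherFiniteIntegralClosure_holds f
  -- finite type over a field ⇒ finite dimensional
  haveI : CompactSpace X :=
    (HasAffineProperty.iff_of_isAffine (P := @QuasiCompact)).mp ‹QuasiCompact f›
  obtain ⟨d, hd⟩ := exists_topologicalKrullDim_le_of_locallyOfFiniteType f
  refine ⟨{ X := normalization X
            hom := normalizationι X ≫ f
            isSeparated := inferInstance
            locallyOfFiniteType := inferInstance
            quasiCompact := inferInstance
            isIntegral := inferInstance
            normal := isIntegrallyClosed_stalk_normalization X }, d + 1, ?_, ?_⟩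
  · -- `dim X^ν = dim X ≤ d < d + 1`
    show topologicalKrullDim (normalization X) < ((d + 1 : ℕ) : WithBot ℕ∞)
    rw [topologicalKrullDim_normalization X f]
    refine lt_of_le_of_lt hd ?_
    exact_mod_cast Nat.lt_succ_self d
  · -- resolutions descend along the proper birational `X^ν → X`
    exact Scheme.HasResolution.of_normalization X f

end Summit.ResolutionOfSingularities.ResolutionOfSingularities.Theorems.LocalToGlobal.HSTower

end
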